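import Summits.BirchSwinnertonDyer.Rank1Residual.AdditivePotMult.TwistTransportLocal
import Literature.NumberTheory.EllipticCurves.VariableChangePointsMap
import HarnessLib

/-!
# The local twist transport `E♭(K̄_E) ≃+ E(K̄_E)` for `C • (E♭)^{(c)} = E` and its SIGN LAW under
# EVERY `σ ∈ Γ_E`: `+` if `σ√c = √c`, `−` if `σ√c = −√c` (team n1011, row T-T3M, seat p12 GEN 9;
# file F3-M — additive-p1's instance-generic `twistPointEquivAlg` + the rational change of
# variables, BY NAME; feeds the twisted Tate parametrisation of the END
# `AdditivePotMult/LocalTowerKernelAtPPotMult`)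

HONEST FRAMING (cell `b2b-bsdres`, run/shared/lean/b2b/bsd-rank1-residual/, verbatim in every
file): the goal of the cell is to DELETE the COMBINATION-SHAPED residual classes of the
Birch–Swinnerton-Dyer formula for ALL analytic-rank `≤ 1` elliptic curves over `ℚ` — "full BSD
formula for every rank `≤ 1` curve in class `C`" assembled STRICTLY from published theorems — so
that the rank-`≤ 1` remainder becomes exactly the CONSTRUCTION-SHAPED classes, which are TYPED
(missing-input `Prop`s), NOT attempted. This is not "finishing BSD". Team n1011 (N10/N11; row
T-T3M, skeleton `cells/n1011/skel/T-T3M.md`): research routes on CONSTRUCTION-SHAPED classes; prove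
what is provable now; no claim beyond stated classes; census output = EVIDENCE, never a Literature
fact; RESIDUAL-MAP marks UNCHANGED; nothing is booked by this file. TOOL THEOREMS ONLY: no
definition, no named fact.

## What

`V`, `c`, a rational change of variables `C` (so `W = C • V^{(c)}` is the situation of the
`p*`-twist model, `AdditivePotMult/PStarTwistModel`: `C • V^{(p*)} = E`), a `ℚ`-field `E`
(a completion `ℚ_v`) and a square root `θ ∈ K̄_E` of `c` with `θ ∉ ℚ`. additive-p1's
`TwistTransportLocal` built the instance-generic substitution
`twistPointEquivAlg V hθ hθc : V^{(c)}(K̄_E) ≃+ V(K̄_E)` with its (anti-)naturality along a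
`ℚ`-algebra map `f` with `f θ = ±θ` (`map_twistPointEquivAlg[_of_neg]`), and proved
`H_E`-equivariance for subgroups `H ≤ Gal(ℚ̄/ℚ(√c))` (`twistLocalEquiv_smul`). THIS FILE records the
sign law for EVERY `σ ∈ Γ_E` (needed at `v ∣ p`, where `√p* ∉ ℚ_v ℚ_{∞,v}`): composing with the
rational substitution `V^{(c)}(K̄_E) ≃+ (C • V^{(c)})(K̄_E)` (tree `pointEquivBaseChange`, equivariant:
`pointEquivBaseChange_map`) there is an additive isomorphism
`T : localPoints V E ≃+ localPoints (C • V^{(c)}) E` with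
`T (σ • P) = σ • T P` if `σ θ = θ` and `T (σ • P) = −(σ • T P)` if `σ θ = −θ`
(`exists_addEquiv_localPoints_sign`), and every `σ` is in one of the two cases
(`smul_sqrt_eq_or_eq_neg`). Stated as an existence: no definition is introduced.

References: [SilvermanAEC2009] J. H. Silverman, *AEC* 2nd ed., X.2 Prop. 2.4, X.5 Cor. 5.4,
III.1; [Dokchitser2013ParityNotes] T. Dokchitser, Notes on the parity conjecture, §4 (the twisted
action); cells/n1011/skel/T-T3M.md.
-/

noncomputable section

open scoped Classical

namespace Summit.BirchSwinnertonDyer.Rank1Residual.AdditivePotMult.TwistLocalSign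

open Literature.NumberTheory.EllipticCurves Literature.NumberTheory.GaloisRepresentations
  WeierstrassCurve Summit.BirchSwinnertonDyer.Rank1Residual.AdditivePotMult

variable (V : WeierstrassCurve ℚ) (C : VariableChange ℚ) (E : Type) [Field E] [Algebra ℚ E]
  {θ : AlgebraicClosure E} {c : ℚ} (hθ : θ ∉ Set.range (algebraMap ℚ (AlgebraicClosure E)))
  (hθc : θ ^ 2 = algebraMap ℚ (AlgebraicClosure E) c)

include hθc in
/-- **Every `σ ∈ Γ_E` maps `θ = √c` to `±θ`**: `(σθ)² = σ(c) = c = θ²`. [folklore] -/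
theorem smul_sqrt_eq_or_eq_neg (σ : Field.absoluteGaloisGroup E) : σ • θ = θ ∨ σ • θ = -θ := by
  have h : (σ • θ) ^ 2 = θ ^ 2 := by
    rw [← smul_pow', hθc]
    exact AlgEquiv.commutes
      ((AlgEquiv.restrictScalars ℚ
        (show AlgebraicClosure E ≃ₐ[E] AlgebraicClosure E from σ) :
        AlgebraicClosure E ≃ₐ[ℚ] AlgebraicClosure E)) c
  exact sq_eq_sq_iff_eq_or_eq_neg.mp h

include hθ hθc in
/-- **The local twist transport with its sign law.** For `V/ℚ`, a rational change of variables `C`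
and `θ = √c ∈ K̄_E ∖ ℚ` there is an additive isomorphism
`T : V(K̄_E) ≃+ (C • V^{(c)})(K̄_E)` — additive-p1's `(twistPointEquivAlg V hθ hθc)⁻¹` followed by
the rational substitution `pointEquivBaseChange V^{(c)} C K̄_E` — such that for every `σ ∈ Γ_E`:
`σθ = θ ⇒ T(σ • P) = σ • T P` and `σθ = −θ ⇒ T(σ • P) = −(σ • T P)`; i.e. through `T` the Galois
module `(C • V^{(c)})(K̄_E)` is `V(K̄_E)` twisted by the quadratic character `σ ↦ σθ/θ`.
(`map_twistPointEquivAlg[_of_neg]` and `pointEquivBaseChange_map` with `f = σ|_{K̄_E}`.)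
[cite: SilvermanAEC2009, X.5 Cor. 5.4] [cite: Dokchitser2013ParityNotes, §4] -/
theorem exists_addEquiv_localPoints_sign :
    ∃ T : localPoints V E ≃+ localPoints (C • V.quadraticTwist c) E,
      ∀ (σ : Field.absoluteGaloisGroup E) (P : localPoints V E),
        (σ • θ = θ → T (σ • P) = σ • T P) ∧ (σ • θ = -θ → T (σ • P) = -(σ • T P)) := by
  -- the two factors, on the underlying point groups over `K̄_E`
  set tw : ((V.quadraticTwist c).baseChange (AlgebraicClosure E)).toAffine.Point ≃+
      (V.baseChange (AlgebraicClosure E)).toAffine.Point :=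
    twistPointEquivAlg V (A := AlgebraicClosure E) hθ hθc with htw
  set pe : ((V.quadraticTwist c).baseChange (AlgebraicClosure E)).toAffine.Point ≃+
      ((C • V.quadraticTwist c).baseChange (AlgebraicClosure E)).toAffine.Point :=
    VariableChange.pointEquivBaseChange (V.quadraticTwist c) C (AlgebraicClosure E) with hpe
  refine ⟨tw.symm.trans pe, fun σ P ↦ ?_⟩
  -- the `ℚ`-algebra endomorphism of `K̄_E` underlying `σ`; the three actions are `Point.map f`
  let f : AlgebraicClosure E →ₐ[ℚ] AlgebraicClosure E :=
    ((AlgEquiv.restrictScalars ℚ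
      (show AlgebraicClosure E ≃ₐ[E] AlgebraicClosure E from σ) :
        AlgebraicClosure E ≃ₐ[ℚ] AlgebraicClosure E) :
      AlgebraicClosure E →ₐ[ℚ] AlgebraicClosure E)
  have hfθ : f θ = σ • θ := rfl
  refine ⟨fun hσ ↦ ?_, fun hσ ↦ ?_⟩
  · -- `σθ = θ`: both factors commute with `σ`
    have key := map_twistPointEquivAlg V hθ hθc hθ hθc f (hfθ.trans hσ)
      (tw.symm (show (V.baseChange (AlgebraicClosure E)).toAffine.Point from P))
    rw [← htw, AddEquiv.apply_symm_apply] at key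
    have h1 : tw.symm (Affine.Point.map f (show (V.baseChange (AlgebraicClosure E)).toAffine.Point
        from P)) = Affine.Point.map f (tw.symm P) := by
      rw [key, AddEquiv.symm_apply_apply]
    show pe (tw.symm (Affine.Point.map f _)) = Affine.Point.map f (pe (tw.symm _))
    rw [h1, hpe, VariableChange.pointEquivBaseChange_map]
  · -- `σθ = −θ`: the twist factor anti-commutes, the rational factor commutes
    have key := map_twistPointEquivAlg_of_neg V hθ hθc hθ hθc f (hfθ.trans hσ)
      (tw.symm (show (V.baseChange (AlgebraicClosure E)).toAffine.Point from P))
    rw [← htw, AddEquiv.apply_symm_apply] at key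
    have h1 : tw.symm (Affine.Point.map f (show (V.baseChange (AlgebraicClosure E)).toAffine.Point
        from P)) = -Affine.Point.map f (tw.symm P) := by
      rw [key, ← map_neg, AddEquiv.symm_apply_apply]
    show pe (tw.symm (Affine.Point.map f _)) = -Affine.Point.map f (pe (tw.symm _))
    rw [h1, map_neg, hpe, VariableChange.pointEquivBaseChange_map]

end Summit.BirchSwinnertonDyer.Rank1Residual.AdditivePotMult.TwistLocalSign

end
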